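import Summits.QuantumFields.YangMills.Theorems.FemtoTransferGapLevels

/-!
# Node N33 of LADDER-YM typed in transfer currency: the femto box COLLAPSES to the one-site model at the running coupling
# (`RunningReduction`, OPEN) + the one-site semiclassics (`OneSiteLevels`, OPEN); seams to N34 and to rung R2b′ PROVED

Third module of the `FemtoTransferGap` group (cell `ym-beyond`, seat P1, memo `run/shared/lean/pub/ym-beyond/ROUTE-P1.md` §30–§32).
`Theorems.FemtoTransferGap` states rung R2b′ (`FemtoGapOfRecord`); `Theorems.FemtoTransferGapLevels` states node N34 (`FemtoLevelsOfRecord`,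
Lüscher's law for the whole low zero-flux spectrum) and proves N34 ⇒ R2b′.  Director-ym's ladder carries BELOW N34 the node N33 «zero-mode
reduction: the femto torus is governed by its constant (zero-momentum) modes at the RUNNING coupling».  This module types N33 over the objects
already in the tree — no new carrier — as a comparison of TWO instances of the same `levelValue`:

* the `SU(2)` Wilson theory on `(ℤ/L)³` at bare coupling `β` in the femto window (running parameter `λ = luscherLambda β L ∈ [lam, 2lam]`), and
* the SAME theory on ONE site (`L = 1`: three link matrices, plaquettes = group commutators) at the **effective one-site coupling**
  `B(β, L) = oneSiteCoupling β L = 2L³/λ³` (`= L³ · (1/ḡ²(ℓ))·2 = L³ β̄(ℓ)`, the running coupling AT THE BOX SCALE spread over the `L³` sites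
  that a constant configuration occupies: the Wilson action of a spatially constant configuration on `(ℤ/L)³` is exactly `L³` times the
  one-site action, and renormalisation replaces `β` by `β̄(ℓ)` [Luscher1983, §3], [LuscherMunster1984, §2]).

Since `bareLambda (2L³/λ³) = λ/L` (PROVED, `bareLambda_oneSiteCoupling`), Lüscher's law `E_k = (λΔ_k + O(λ²))/L` on the femto torus is
EQUIVALENT, level by level, to «the femto torus has the one-site spectrum at coupling `B(β,L)` up to `O(λ²/L)` in `L·E`» GIVEN the one-site
semiclassics `E_k^{os}(B) = λ_b Δ_k + O(λ_b²)`, `λ_b = (2/B)^{1/3}`.  The two halves are the two OPEN leaves of this module; neither implies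
N34 or the rung alone.

## Contents
* `oneSiteCoupling β L = 2L³/λ(β,L)³`; PROVED `bareLambda_oneSiteCoupling : 0 < λ → bareLambda (oneSiteCoupling β L) = λ/L` and
  `oneSiteCoupling_eq : 0 < 1/ḡ² → oneSiteCoupling β L = 2·(1/ḡ²(ℓ))·L³`.
* `OneSiteLevels` (`@[conjecture]`, OPEN — finite-dimensional): for every `k`, `∃ C B₀, ∀ B ≥ B₀`, `0 < λ₀^{os}(B)` and the two-sided bound
  `e^{−(λ_bΔ_k + Cλ_b²)} λ₀^{os} ≤ λ_k^{os} ≤ e^{−(λ_bΔ_k − Cλ_b²)} λ₀^{os}` for the one-site zero-flux transfer values.  Semiclassics of a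
  quantum mechanics on `SU(2)³` (9 degrees of freedom) at the conical valley of commuting triples; the `k = 1` upper half is `FemtoGapOneSite`
  (PROVED `femtoGapOneSite_of_oneSiteLevels`).  Numerically decidable (character-basis diagonalisation / Monte Carlo of the `1³ × N_t` lattice).
* `RunningReduction` (`@[conjecture]`, OPEN — the hard leaf, N33 proper): in the femto window, for `L ≥ L₀(k, lam)`,
  `λ_k(β,L)·λ₀^{os}(B) ≤ e^{Cλ²/L} λ_k^{os}(B)·λ₀(β,L)` and `λ_k^{os}(B)·λ₀(β,L) ≤ e^{Cλ²/L} λ_k(β,L)·λ₀^{os}(B)`, `B = oneSiteCoupling β L` —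
  i.e. `|L·E_k(β,L) − L·E_k^{os}(B(β,L))| ≤ Cλ²`: integrating out the `3(L³−1)` non-constant modes renormalises the coupling and nothing else at
  this order.  This is where the uniform-in-`L` (small-volume continuum-limit) control lives: Bałaban-type background-field renormalisation on the
  femto torus composed with the transfer-matrix formalism; no proof in print.
* SEAMS (PROVED): `femtoLevels_of_reduction : OneSiteLevels → RunningReduction → FemtoLevelsOfRecord`,
  `femtoGapOfRecord_of_reduction : OneSiteLevels → RunningReduction → FemtoGapOfRecord`, `femtoGapOneSite_of_oneSiteLevels`.

## WHAT THIS IS NOT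
Not a proof of anything about Yang–Mills; not a claim that the one-site model IS the femto universe beyond the stated order (the true
discrepancy is the one-loop effective potential of the constant modes, `O(ḡ^{4/3}) = O(λ²)` in `L·E` [KollerVanbaal1986, eq. (29)], which is
exactly the slack allowed); nothing about electric flux, non-zero momenta, or `L → ∞` at fixed `β`; NOT THE CLAY GAP.  `[status: open]`
docstrings are conjectures of record (ladder node text, never summit credit).
-/

set_option autoImplicit false

noncomputable section

open MeasureTheory Filter Topology Real
open Literature.MathematicalPhysics.QuantumFieldTheory
open Literature.MathematicalPhysics.QuantumLattice
open Literature.Analysis.OperatorTheory.YMMatrixModel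

namespace Summit.QuantumFields.YangMills.Theorems.FemtoTransferGap

/-! ## The effective one-site coupling -/

/-- **Effective one-site coupling** `B(β, L) = 2L³/λ(β,L)³ = 2L³/ḡ²(ℓ)`: the coupling at which the ONE-SITE model (`L = 1`) reproduces the
constant-mode sector of the `(ℤ/L)³` theory renormalised at the box scale (a spatially constant configuration has Wilson action `L³ ×` the
one-site action; `β ↦ β̄(ℓ) = 2/ḡ²(ℓ)` is the renormalisation). Junk (`2L³/0 = 0`) outside the asymptotically free side, never used there.
[cite: Luscher1983, §3] [cite: LuscherMunster1984, §2] -/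
def oneSiteCoupling (β : ℝ) (L : ℕ) : ℝ := 2 * (L : ℝ) ^ 3 / luscherLambda β L ^ 3

/-- On the asymptotically free side `B(β,L) = 2 · (1/ḡ²(ℓ)) · L³` (`λ³ = ḡ²`). [cite: LuscherMunster1984, §2] -/
theorem oneSiteCoupling_eq {β : ℝ} {L : ℕ} (h : 0 < invRunningCoupling β L) :
    oneSiteCoupling β L = 2 * invRunningCoupling β L * (L : ℝ) ^ 3 := by
  unfold oneSiteCoupling luscherLambda
  rw [max_eq_left h.le]
  have h3 : ((invRunningCoupling β L) ^ (-(1 : ℝ) / 3)) ^ 3 = (invRunningCoupling β L)⁻¹ := by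
    rw [← Real.rpow_natCast, ← Real.rpow_mul h.le]
    norm_num
    exact Real.rpow_neg_one (invRunningCoupling β L)
  rw [h3]
  field_simp

/-- **The bare parameter of the one-site model at the effective coupling is the running parameter per site: `(2/B)^{1/3} = λ/L`.**
This identity is what makes the one-site law `E^{os}_k = λ_b Δ_k` and Lüscher's law `E_k = λΔ_k/L` the same statement. [folklore] -/
theorem bareLambda_oneSiteCoupling {β : ℝ} {L : ℕ} [NeZero L] (hl : 0 < luscherLambda β L) :
    bareLambda (oneSiteCoupling β L) = luscherLambda β L / L := by
  have hL : (0 : ℝ) < L := Nat.cast_pos.mpr (NeZero.pos L)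
  unfold bareLambda oneSiteCoupling
  have hq : 2 / (2 * (L : ℝ) ^ 3 / luscherLambda β L ^ 3) = (luscherLambda β L / L) ^ 3 := by
    field_simp
  rw [hq]
  have h13 : ((1 : ℝ) / 3) = ((3 : ℕ) : ℝ)⁻¹ := by norm_num
  rw [h13]
  exact Real.pow_rpow_inv_natCast (div_nonneg hl.le hL.le) (by norm_num)

/-- In the window `λ > 0` (since `0 < lam ≤ λ`). [folklore] -/
theorem luscherLambda_pos_of_window {lam β : ℝ} {L : ℕ} (hlam : 0 < lam) (h : InFemtoWindow lam β L) :
    0 < luscherLambda β L := lt_of_lt_of_le hlam h.2.1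

/-- In the window the effective one-site coupling is large: `B(β,L) ≥ 1/(4 lam³)` (`λ ≤ 2 lam`, `L ≥ 1`). [folklore] -/
theorem oneSiteCoupling_ge_of_window {lam β : ℝ} {L : ℕ} [NeZero L] (hlam : 0 < lam) (h : InFemtoWindow lam β L) :
    1 / (4 * lam ^ 3) ≤ oneSiteCoupling β L := by
  have hl : 0 < luscherLambda β L := luscherLambda_pos_of_window hlam h
  have hL1 : (1 : ℝ) ≤ L := by exact_mod_cast NeZero.one_le
  have hle : luscherLambda β L ≤ 2 * lam := h.2.2
  unfold oneSiteCoupling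
  rw [div_le_div_iff₀ (by positivity) (by positivity), one_mul]
  have h1 : luscherLambda β L ^ 3 ≤ (2 * lam) ^ 3 := by gcongr
  have h2 : (1 : ℝ) ≤ (L : ℝ) ^ 3 := one_le_pow₀ hL1
  nlinarith [h1, h2, pow_pos hlam 3]

/-! ## The two OPEN leaves -/

/-- **LEAF `OneSiteLevels` — semiclassics of the one-site three-matrix model (finite-dimensional; numerically decidable).**  For the `SU(2)`
Wilson theory on ONE spatial site (links `U₁,U₂,U₃ ∈ SU(2)`, plaquettes = group commutators, transfer kernel of `Theorems.FemtoTransferGap`,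
zero flux = invariance under `U_k ↦ −U_k`), for every level index `k` there are `C, B₀` with, for all `B ≥ B₀`: the top value is positive and
`e^{−(λ_bΔ_k + Cλ_b²)} λ₀ ≤ λ_k ≤ e^{−(λ_bΔ_k − Cλ_b²)} λ₀`, `λ_b = (2/B)^{1/3}`, `Δ_k = levelGap k` — i.e. the low zero-flux spectrum of
`−log K_B` is `λ_b · spec(𝔥) + O(λ_b²)` (in fact `O(λ_b³)`: Haar-measure, Taylor and symmetric-splitting corrections are all relative `O(λ_b²)`).
WHY TRUE (not yet a proof): in exponential coordinates `U_k = exp(i c_k·σ/2)`, `c = λ_b x`, the kernel is `e^{−λ_b 𝔥 + O(λ_b³)}` near each of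
the 8 twist copies `U ∈ {±1}³` of the classical vacuum; states elsewhere on the valley of commuting triples cost `O(1) ≫ λ_b`; the flip-even
projection keeps one copy of each `𝔥`-level (tunnelling splittings are exponentially small); multi-well semiclassics with a degenerate
(conical) critical set [SimonB1983DiscreteSpectrum], [HelfferSjostrand1984].  WHY IT MIGHT FAIL: only through a wrong normalisation in this
module group (`β = 2/g₀²`, kinetic `e^{−(B/4)|c−c'|²}`, magnetic `(B/8)Σ|c_k×c_l|²`) — which is exactly what the Monte-Carlo falsifier tests
(`E(2⁺)·(B/2)^{1/3} → 1.898`, `E(0⁺)/E(2⁺) → 1.196`).  Positivity `0 < λ₀` holds for every `B` (`K_B > 0` continuous on a compact group).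
[cite: Luscher1983, §2] [cite: SimonB1983DiscreteSpectrum, eq. (3) p. 211] [cite: HelfferSjostrand1984] [status: open] -/
@[conjecture] def OneSiteLevels : Prop :=
  ∀ k : ℕ, ∃ C B0 : ℝ, ∀ B : ℝ, B0 ≤ B →
    0 < levelValue su2Rep 1 B 0 ∧
      levelValue su2Rep 1 B k ≤
          Real.exp (-(levelGap k * bareLambda B - C * bareLambda B ^ 2)) * levelValue su2Rep 1 B 0 ∧
        Real.exp (-(levelGap k * bareLambda B + C * bareLambda B ^ 2)) * levelValue su2Rep 1 B 0 ≤
          levelValue su2Rep 1 B k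

/-- **LEAF `RunningReduction` — node N33 of LADDER-YM: the femto box collapses to ONE SITE AT THE RUNNING COUPLING, at cost `O(λ²)` in `L·E`.**
For every level index `k` there are `C` and `λ₀ > 0` such that for every `0 < lam ≤ λ₀`, all `L ≥ L₀(k, lam)` and every `β` in the femto
window, with `B = oneSiteCoupling β L = 2L³/λ³`:
`λ_k(β,L)·λ₀^{os}(B) ≤ e^{Cλ²/L}·λ_k^{os}(B)·λ₀(β,L)` and `λ_k^{os}(B)·λ₀(β,L) ≤ e^{Cλ²/L}·λ_k(β,L)·λ₀^{os}(B)`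
(cross-multiplied form of `|log(λ_k/λ₀) − log(λ_k^{os}/λ₀^{os})| ≤ Cλ²/L`, robust to the junk value `0`).  CONTENT: the `3(L³−1)` non-constant
modes of the femto torus are stiff (energies `≥ 2π/L ≫ λ/L`); integrating them out in renormalised perturbation theory around the constant-mode
background replaces `β` by the running `β̄(ℓ) = 2/ḡ²(ℓ)` in the constant-mode (= one-site, exactly: a constant configuration has action `L³×`
the one-site action) dynamics and adds an effective potential of relative size `O(ḡ^{2/3}) = O(λ)`, i.e. `O(λ²/L)` in `E` [Luscher1983, §3–4],
[LuscherMunster1984], [KollerVanbaal1986, eq. (29)].  The two-loop label `luscherLambda` absorbs the scheme constant into `O(λ⁴/L)`.  OPEN: a proof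
needs NON-PERTURBATIVE, UNIFORM-IN-`L` control of the lattice transfer spectrum in a box of fixed running coupling — the small-volume continuum
limit (Bałaban's ultraviolet renormalisation-group technology on the femto torus, composed with reflection positivity / the transfer-matrix
formalism and the degenerate-valley semiclassics); nothing of the kind is in print.  WHY IT MIGHT FAIL: as a statement of physics it is Lüscher's
universally accepted small-volume expansion; as typed it could fail only through the window label (three-loop terms are `O(λ³·λ/L)`, inside the
slack) or if the `O(λ)`-relative one-loop potential shifted a level by MORE than `O(λ²/L)` — it does not ([KollerVanbaal1986]: next term `ḡ^{4/3}`).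
NOT THE CLAY GAP. [cite: Luscher1983, §3] [cite: LuscherMunster1984, §2] [cite: KollerVanbaal1986, eq. (29)] [status: open] -/
@[conjecture] def RunningReduction : Prop :=
  ∀ k : ℕ, ∃ C lam0 : ℝ, 0 < lam0 ∧ ∀ lam : ℝ, 0 < lam → lam ≤ lam0 →
    ∃ L0 : ℕ, ∀ (L : ℕ) [NeZero L], L0 ≤ L → ∀ β : ℝ, InFemtoWindow lam β L →
      levelValue su2Rep L β k * levelValue su2Rep 1 (oneSiteCoupling β L) 0 ≤
          Real.exp (C * luscherLambda β L ^ 2 / L) *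
            (levelValue su2Rep 1 (oneSiteCoupling β L) k * levelValue su2Rep L β 0) ∧
        levelValue su2Rep 1 (oneSiteCoupling β L) k * levelValue su2Rep L β 0 ≤
          Real.exp (C * luscherLambda β L ^ 2 / L) *
            (levelValue su2Rep L β k * levelValue su2Rep 1 (oneSiteCoupling β L) 0)

/-! ## Seams (proved) -/

/-- The `k = 1` upper half of `OneSiteLevels` is the one-site leaf of the rung module. [folklore] -/
theorem femtoGapOneSite_of_oneSiteLevels (h : OneSiteLevels) : FemtoGapOneSite := by
  obtain ⟨C, B0, H⟩ := h 1
  refine ⟨C, B0, fun B hB => ?_⟩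
  have h1 := (H B hB).2.1
  rw [levelValue_one, levelValue_zero, levelGap_one] at h1
  simpa using h1

/-- Exponent bookkeeping for the seam: with `l/L` for `λ_b` and `|C_A| + |C_B|` for `C`, the one-site and reduction slacks add up inside
`Cλ²/L` (uses `L ≥ 1`). [folklore] -/
private theorem slack_le {CA CB l : ℝ} {L : ℝ} (hL : 1 ≤ L) :
    CB * l ^ 2 / L + CA * (l / L) ^ 2 ≤ (|CA| + |CB|) * l ^ 2 / L := by
  have hL0 : 0 < L := by linarith
  have h1 : CB * l ^ 2 / L ≤ |CB| * l ^ 2 / L := by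
    gcongr; exact le_abs_self CB
  have h2 : CA * (l / L) ^ 2 ≤ |CA| * l ^ 2 / L := by
    have h2a : CA * (l / L) ^ 2 ≤ |CA| * (l / L) ^ 2 := by gcongr; exact le_abs_self CA
    have h2b : |CA| * (l / L) ^ 2 ≤ |CA| * l ^ 2 / L := by
      rw [div_pow, ← mul_div_assoc]
      apply div_le_div_of_nonneg_left (by positivity) hL0
      nlinarith
    exact h2a.trans h2b
  calc CB * l ^ 2 / L + CA * (l / L) ^ 2 ≤ |CB| * l ^ 2 / L + |CA| * l ^ 2 / L := add_le_add h1 h2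
    _ = (|CA| + |CB|) * l ^ 2 / L := by ring

/-- **SEAM (proved): `OneSiteLevels → RunningReduction → FemtoLevelsOfRecord` (N33 ∧ one-site semiclassics ⇒ N34).**  In the window put
`B = 2L³/λ³`; then `λ_b(B) = λ/L` (`bareLambda_oneSiteCoupling`) and `B ≥ 1/(4lam³) ≥ B₀` once `lam ≤ min(λ₀, 1/(4 max(B₀,1)))`; chain the
one-site two-sided bound (exponent `−(λΔ_k ∓ C_Aλ²/L)/L`) with the reduction (exponent `± C_Bλ²/L`), cancel `λ₀^{os}(B) > 0`, and absorb
`C_Aλ²/L² + C_Bλ²/L ≤ (|C_A|+|C_B|)λ²/L`. -/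
theorem femtoLevels_of_reduction (hA : OneSiteLevels) (hB : RunningReduction) : FemtoLevelsOfRecord := by
  intro k
  obtain ⟨CA, B0, HA⟩ := hA k
  obtain ⟨CB, lam0, hlam0, HB⟩ := hB k
  set M : ℝ := max B0 1 with hM
  have hM1 : 1 ≤ M := le_max_right _ _
  have hM0 : 0 < M := by linarith
  refine ⟨|CA| + |CB|, min lam0 (1 / (4 * M)), lt_min hlam0 (by positivity), fun lam hlam hle => ?_⟩
  have hle0 : lam ≤ lam0 := hle.trans (min_le_left _ _)
  have hleM : lam ≤ 1 / (4 * M) := hle.trans (min_le_right _ _)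
  obtain ⟨L0, HL⟩ := HB lam hlam hle0
  refine ⟨L0, ?_⟩
  intro L _ hL β hw
  -- abbreviations
  set l : ℝ := luscherLambda β L with hl_def
  set B : ℝ := oneSiteCoupling β L with hB_def
  have hl : 0 < l := luscherLambda_pos_of_window hlam hw
  have hLpos : (0 : ℝ) < L := Nat.cast_pos.mpr (NeZero.pos L)
  have hL1 : (1 : ℝ) ≤ L := by exact_mod_cast NeZero.one_le
  -- B ≥ B0
  have hBge : B0 ≤ B := by
    have h1 : 1 / (4 * lam ^ 3) ≤ B := oneSiteCoupling_ge_of_window hlam hw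
    have hlam1 : lam ≤ 1 := by
      have : 1 / (4 * M) ≤ 1 := by
        rw [div_le_one (by positivity)]; linarith
      exact hleM.trans this
    have hlam3 : lam ^ 3 ≤ lam := by
      have : lam ^ 3 = lam * (lam * lam) := by ring
      rw [this]
      have h2 : lam * lam ≤ 1 := by nlinarith
      nlinarith
    have h2 : M ≤ 1 / (4 * lam ^ 3) := by
      rw [le_div_iff₀ (by positivity)]
      have h3 : lam ≤ 1 / (4 * M) := hleM
      rw [le_div_iff₀ (by positivity)] at h3
      nlinarith [pow_pos hlam 3]
    exact (le_max_left B0 1).trans (h2.trans h1)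
  obtain ⟨hpos, hupA, hlowA⟩ := HA B hBge
  have hlb : bareLambda B = l / L := bareLambda_oneSiteCoupling hl
  rw [hlb] at hupA hlowA
  obtain ⟨hupB, hlowB⟩ := HL L hL β hw
  -- positivity of the full top value
  have htop : 0 ≤ levelValue su2Rep L β 0 := by rw [levelValue_zero]; exact topValue_nonneg su2Rep L β
  have hslack : CB * l ^ 2 / L + CA * (l / L) ^ 2 ≤ (|CA| + |CB|) * l ^ 2 / L := slack_le hL1
  -- names
  set lk := levelValue su2Rep L β k with hlk
  set l0 := levelValue su2Rep L β 0 with hl0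
  set sk := levelValue su2Rep 1 B k with hsk
  set s0 := levelValue su2Rep 1 B 0 with hs0
  constructor
  · -- upper bound
    have h1 : lk * s0 ≤ Real.exp (CB * l ^ 2 / L) *
        (Real.exp (-(levelGap k * (l / L) - CA * (l / L) ^ 2)) * s0) * l0 := by
      calc lk * s0 ≤ Real.exp (CB * l ^ 2 / L) * (sk * l0) := hupB
        _ ≤ Real.exp (CB * l ^ 2 / L) * ((Real.exp (-(levelGap k * (l / L) - CA * (l / L) ^ 2)) * s0) * l0) := by
          gcongr
        _ = _ := by ring
    have h2 : lk * s0 ≤ (Real.exp (CB * l ^ 2 / L + -(levelGap k * (l / L) - CA * (l / L) ^ 2)) * l0) * s0 := by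
      rw [Real.exp_add]; linarith [h1]
    have h3 : lk ≤ Real.exp (CB * l ^ 2 / L + -(levelGap k * (l / L) - CA * (l / L) ^ 2)) * l0 :=
      le_of_mul_le_mul_right h2 hpos
    refine h3.trans ?_
    gcongr
    · rw [neg_div, neg_sub, sub_div]
      have : levelGap k * (l / L) = levelGap k * l / L := by ring
      rw [this]
      linarith [hslack]
  · -- lower bound
    have h1 : Real.exp (-(levelGap k * (l / L) + CA * (l / L) ^ 2)) * s0 * l0 ≤ sk * l0 :=
      mul_le_mul_of_nonneg_right hlowA htop
    have h2 : Real.exp (-(levelGap k * (l / L) + CA * (l / L) ^ 2)) * s0 * l0 ≤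
        Real.exp (CB * l ^ 2 / L) * (lk * s0) := h1.trans hlowB
    have h3 : (Real.exp (-(levelGap k * (l / L) + CA * (l / L) ^ 2)) * l0) * s0 ≤
        (Real.exp (CB * l ^ 2 / L) * lk) * s0 := by
      calc _ = Real.exp (-(levelGap k * (l / L) + CA * (l / L) ^ 2)) * s0 * l0 := by ring
        _ ≤ Real.exp (CB * l ^ 2 / L) * (lk * s0) := h2
        _ = _ := by ring
    have h4 : Real.exp (-(levelGap k * (l / L) + CA * (l / L) ^ 2)) * l0 ≤ Real.exp (CB * l ^ 2 / L) * lk :=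
      le_of_mul_le_mul_right h3 hpos
    -- divide by exp(CB l²/L)
    have h5 : Real.exp (-(levelGap k * (l / L) + CA * (l / L) ^ 2) - CB * l ^ 2 / L) * l0 ≤ lk := by
      rw [Real.exp_sub, div_mul_eq_mul_div, div_le_iff₀ (Real.exp_pos _)]
      calc Real.exp (-(levelGap k * (l / L) + CA * (l / L) ^ 2)) * l0 ≤ Real.exp (CB * l ^ 2 / L) * lk := h4
        _ = lk * Real.exp (CB * l ^ 2 / L) := by ring
    refine le_trans ?_ h5
    gcongr
    · rw [neg_div, add_div]
      have : levelGap k * (l / L) = levelGap k * l / L := by ring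
      rw [this]
      linarith [hslack]

/-- **SEAM (proved): `OneSiteLevels → RunningReduction → FemtoGapOfRecord`** (N33 ∧ one-site semiclassics ⇒ rung R2b′), through N34. -/
theorem femtoGapOfRecord_of_reduction (hA : OneSiteLevels) (hB : RunningReduction) : FemtoGapOfRecord :=
  femtoGapOfRecord_of_levels (femtoLevels_of_reduction hA hB)

end Summit.QuantumFields.YangMills.Theorems.FemtoTransferGap

end
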